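import Literature.Computability.Complexity.StackArith
import HarnessLib

/-!
# The threshold test `⟨1ᵀ, bin v⟩ ↦ [T ≤ v]` is polynomial time (a stack program; trunk CplxCore)

A small program library entry for the structured stack programs `Com` of `StackPrograms.lean`
(`Com.mem_FP`), in the style of `BinarySubtraction.lean` / `StackArith.lean`: the comparison of
a threshold given **in unary** (the length of the first component of a pair) with a number given
**in binary** (Mathlib's little-endian `Computability.encodeNat`, the output convention of the
tree's natural-number-valued algorithms, e.g. the heuristics `ℋ : RandAlg (List Bool) ℕ` read
through `IsPPT ℋ encodeNat`):

* `unLeBinFn ∈ FP` (`unLeBinFn_mem_FP`) with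
  `unLeBinFn (boolPair u (encodeNat v)) = [decide (|u| ≤ v)]` (`unLeBinFn_boolPair`), i.e. the
  output is `encodeBool` of the test (`unLeBinFn_boolPair_eq_encodeBool`).

This is the final stage of threshold distinguishers "accept iff `ℋ(x) ≥ θ`" with a polynomially
bounded threshold `θ` (Liu–Pass's distinguisher in the proof of Thm 5.2 of *On one-way functions and
Kolmogorov complexity*, FOCS 2020, served in `LiuPassPaddingProofs.lean`); the point of the mixed
unary/binary format is that `v` may be exponentially large while `θ` is not.

The program (`UnLeBin.prog`, registers `UnLeBin.Rg`): parse the pair, counting the bits of the first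
component in unary (`tt`, which then serves as the *budget* `T - acc`) and pouring the second
component onto `v` (so most significant bit on top); then a Horner pass over the bits of `v`
maintaining `acc = min (value read so far) T` in unary **capped at `T`** (doubling = one more unit
per unit of `acc` while the budget lasts, `UnLeBin.dbl`; plus one for a `1` bit, `UnLeBin.take1`), so
that all registers stay of linear size; finally `T ≤ v` iff the budget is exhausted. Cost
`≤ 12|z|² + 16|z| + 5`. Specifications are total (`UnLeBin.parseSpec`, `UnLeBin.hornerN`), exact
register files (`UnLeBin.mk`), as in `BinarySubtraction.lean`.

## References

* S. Arora, B. Barak, *Computational Complexity: A Modern Approach*, CUP 2009, §1.3 (robustness of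
  polynomial time; arithmetic and comparisons on binary numerals), Thm. 2.8 (composition).
* T. Nipkow, G. Klein, *Concrete Semantics*, Springer 2014, Ch. 7–8 (big-step verification style).
* Y. Liu, R. Pass, *On one-way functions and Kolmogorov complexity*, FOCS 2020, proof of Thm 5.2
  (the threshold distinguisher served).
-/

namespace Literature.Computability.Complexity

open _root_.Computability

namespace UnLeBin

/-- Registers of the threshold program: input, the unary threshold / budget, the binary number
(most significant bit on top), the capped accumulator and its double buffer, the output. [folklore] -/
inductive Rg
  | inp | tt | v | acc | acc2 | out
  deriving DecidableEq, Fintype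

open Com

/-- Explicit register files. [folklore] -/
def mk (zinp ztt zv zacc zacc2 zout : List Bool) : Regs Rg := fun r =>
  match r with
  | .inp => zinp | .tt => ztt | .v => zv | .acc => zacc | .acc2 => zacc2 | .out => zout

section MkLemmas

variable (zinp ztt zv zacc zacc2 zout x : List Bool)

/-- Reading register `inp`. [folklore] -/
@[simp] theorem mk_inp : mk zinp ztt zv zacc zacc2 zout .inp = zinp := rfl
/-- Reading register `tt`. [folklore] -/
@[simp] theorem mk_tt : mk zinp ztt zv zacc zacc2 zout .tt = ztt := rfl
/-- Reading register `v`. [folklore] -/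
@[simp] theorem mk_v : mk zinp ztt zv zacc zacc2 zout .v = zv := rfl
/-- Reading register `acc`. [folklore] -/
@[simp] theorem mk_acc : mk zinp ztt zv zacc zacc2 zout .acc = zacc := rfl
/-- Reading register `acc2`. [folklore] -/
@[simp] theorem mk_acc2 : mk zinp ztt zv zacc zacc2 zout .acc2 = zacc2 := rfl
/-- Reading register `out`. [folklore] -/
@[simp] theorem mk_out : mk zinp ztt zv zacc zacc2 zout .out = zout := rfl

/-- Updating register `inp`. [folklore] -/
@[simp] theorem update_inp : Function.update (mk zinp ztt zv zacc zacc2 zout) .inp x =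
    mk x ztt zv zacc zacc2 zout := by
  funext r; cases r <;> simp
/-- Updating register `tt`. [folklore] -/
@[simp] theorem update_tt : Function.update (mk zinp ztt zv zacc zacc2 zout) .tt x =
    mk zinp x zv zacc zacc2 zout := by
  funext r; cases r <;> simp
/-- Updating register `v`. [folklore] -/
@[simp] theorem update_v : Function.update (mk zinp ztt zv zacc zacc2 zout) .v x =
    mk zinp ztt x zacc zacc2 zout := by
  funext r; cases r <;> simp
/-- Updating register `acc`. [folklore] -/
@[simp] theorem update_acc : Function.update (mk zinp ztt zv zacc zacc2 zout) .acc x =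
    mk zinp ztt zv x zacc2 zout := by
  funext r; cases r <;> simp
/-- Updating register `acc2`. [folklore] -/
@[simp] theorem update_acc2 : Function.update (mk zinp ztt zv zacc zacc2 zout) .acc2 x =
    mk zinp ztt zv zacc x zout := by
  funext r; cases r <;> simp
/-- Updating register `out`. [folklore] -/
@[simp] theorem update_out : Function.update (mk zinp ztt zv zacc zacc2 zout) .out x =
    mk zinp ztt zv zacc zacc2 x := by
  funext r; cases r <;> simp

end MkLemmas

/-- The initial register file is `mk z [] … []`. [folklore] -/
theorem init_eq (z : List Bool) : Regs.init Rg.inp z = mk z [] [] [] [] [] := by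
  funext r; cases r <;> simp [Regs.init, mk]

/-- Unary register contents `1ⁿ`. [folklore] -/
abbrev un (n : ℕ) : List Bool := List.replicate n true

/-- `1ⁿ⁺¹ = 1 :: 1ⁿ`. [folklore] -/
theorem un_succ (n : ℕ) : un (n + 1) = true :: un n := rfl

/-! #### Parsing the pair -/

/-- Loop body after a first bit `1`: a second `1` is a bit of the first component (one unit of the
threshold); `10` is malformed (ignored). [folklore] -/
def bodyT : Com Rg := pop .inp (push .tt true) skip skip

/-- Loop body after a first bit `0`: `01` is the separator (pour the second component onto `v`,
most significant bit on top), `00` is a bit of the first component. [folklore] -/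
def bodyF : Com Rg := pop .inp (pour .inp .v) (push .tt true) skip

/-- The parser of `boolPair u w`: afterwards `tt = 1^{|u|}`, `v = reverse w`. [folklore] -/
def parse : Com Rg := loop .inp bodyT bodyF

/-- Functional semantics of `parse`: the number of units added to `tt` and the final `v`. [folklore] -/
def parseSpec : List Bool → ℕ → ℕ × List Bool
  | [], T => (T, [])
  | [_], T => (T, [])
  | true :: true :: z, T => parseSpec z (T + 1)
  | true :: false :: z, T => parseSpec z T
  | false :: false :: z, T => parseSpec z (T + 1)
  | false :: true :: z, T => (T, z.reverse)

/-- **Semantics of `parse`** (cost `≤ 5|z| + 1`). [folklore] -/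
theorem runs_parse : ∀ (z : List Bool) (T : ℕ) (d e f : List Bool),
    Runs parse (mk z (un T) [] d e f) (mk [] (un (parseSpec z T).1) (parseSpec z T).2 d e f)
      (5 * z.length + 1)
  | [], T, d, e, f => Runs.loop_nil _ _ rfl
  | [a], T, d, e, f => by
    have hrest : Runs parse (mk [] (un T) [] d e f) (mk [] (un T) [] d e f) 1 := Runs.loop_nil _ _ rfl
    refine Runs.mono ?_ (show (0 + 2) + 2 + 1 ≤ 5 * [a].length + 1 by simp)
    cases a
    · exact Runs.loop_false' (w := []) rfl (update_inp ..) (Runs.pop_nil _ _ rfl (Runs.skip _)) hrest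
    · exact Runs.loop_true' (w := []) rfl (update_inp ..) (Runs.pop_nil _ _ rfl (Runs.skip _)) hrest
  | true :: true :: z, T, d, e, f => by
    have ih := runs_parse z (T + 1) d e f
    refine Runs.mono ?_ (show (1 + 2) + 2 + (5 * z.length + 1) ≤ 5 * (true :: true :: z).length + 1 by
      simp; omega)
    exact Runs.loop_true' rfl (update_inp ..)
      (Runs.pop_true' _ _ rfl (update_inp ..) (Runs.push' (update_tt ..))) ih
  | true :: false :: z, T, d, e, f => by
    have ih := runs_parse z T d e f
    refine Runs.mono ?_ (show (0 + 2) + 2 + (5 * z.length + 1) ≤ 5 * (true :: false :: z).length + 1 by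
      simp; omega)
    exact Runs.loop_true' rfl (update_inp ..)
      (Runs.pop_false' _ _ rfl (update_inp ..) (Runs.skip _)) ih
  | false :: false :: z, T, d, e, f => by
    have ih := runs_parse z (T + 1) d e f
    refine Runs.mono ?_ (show (1 + 2) + 2 + (5 * z.length + 1) ≤ 5 * (false :: false :: z).length + 1 by
      simp; omega)
    exact Runs.loop_false' rfl (update_inp ..)
      (Runs.pop_false' _ _ rfl (update_inp ..) (Runs.push' (update_tt ..))) ih
  | false :: true :: z, T, d, e, f => by
    have hpour : Runs (pour .inp .v) (mk z (un T) [] d e f) (mk [] (un T) z.reverse d e f)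
        (3 * z.length + 1) := by
      have := runs_pour (a := Rg.inp) (b := Rg.v) (by decide) (mk z (un T) [] d e f)
      simpa using this
    have hrest : Runs parse (mk [] (un T) z.reverse d e f) (mk [] (un T) z.reverse d e f) 1 :=
      Runs.loop_nil _ _ rfl
    refine Runs.mono ?_ (show ((3 * z.length + 1) + 2) + 2 + 1 ≤ 5 * (false :: true :: z).length + 1 by
      simp; omega)
    exact Runs.loop_false' rfl (update_inp ..) (Runs.pop_true' _ _ rfl (update_inp ..) hpour) hrest

/-- `parse` on a pair: `|u|` more units, `v = reverse w`. [folklore] -/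
theorem parseSpec_boolPair : ∀ (u w : List Bool) (T : ℕ),
    parseSpec (boolPair u w) T = (T + u.length, w.reverse)
  | [], w, T => by simp [boolPair, parseSpec]
  | b :: u, w, T => by
    have hcons : boolPair (b :: u) w = b :: b :: boolPair u w := by simp [boolPair]
    rw [hcons]
    cases b
    · rw [parseSpec, parseSpec_boolPair u w]
      simp only [List.length_cons, Prod.mk.injEq, and_true]; omega
    · rw [parseSpec, parseSpec_boolPair u w]
      simp only [List.length_cons, Prod.mk.injEq, and_true]; omega

/-- Sizes after parsing: `T' + |v| ≤ T + |z|`. [folklore] -/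
theorem parseSpec_le : ∀ (z : List Bool) (T : ℕ),
    (parseSpec z T).1 + (parseSpec z T).2.length ≤ T + z.length
  | [], T => by simp [parseSpec]
  | [_], T => by simp [parseSpec]
  | true :: true :: z, T => by have := parseSpec_le z (T + 1); simp [parseSpec] at this ⊢; omega
  | true :: false :: z, T => by have := parseSpec_le z T; simp [parseSpec] at this ⊢; omega
  | false :: false :: z, T => by have := parseSpec_le z (T + 1); simp [parseSpec] at this ⊢; omega
  | false :: true :: z, T => by simp [parseSpec]; omega

/-! #### The capped Horner pass -/

/-- Transfer one unit of budget to the double buffer, if any is left. [folklore] -/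
def take1 : Com Rg := pop .tt (push .acc2 true) (push .acc2 true) skip

/-- Body of the doubling loop: keep the unit and add one more from the budget. [folklore] -/
def dblBody : Com Rg := push .acc2 true ;; take1

/-- Capped doubling: `acc2 := acc + min acc bud`, `bud := bud - min acc bud`, `acc := 0`. [folklore] -/
def dbl : Com Rg := loop .acc dblBody dblBody

/-- One Horner step for the bit `b`: double (capped), add `b` (capped), move back to `acc`. [folklore] -/
def stepB (b : Bool) : Com Rg := dbl ;; (bif b then take1 else skip) ;; pour .acc2 .acc

/-- The Horner pass over the bits of `v` (most significant first). [folklore] -/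
def horner : Com Rg := loop .v (stepB true) (stepB false)

/-- The arithmetic of `take1` on `(acc2, bud)`. [folklore] -/
def takeN (p : ℕ × ℕ) : ℕ × ℕ := if p.2 = 0 then p else (p.1 + 1, p.2 - 1)

/-- The arithmetic of one Horner step on `(acc, bud)`. [folklore] -/
def stepN (b : Bool) (p : ℕ × ℕ) : ℕ × ℕ :=
  let q : ℕ × ℕ := (p.1 + min p.1 p.2, p.2 - min p.1 p.2)
  bif b then takeN q else q

/-- The arithmetic of the Horner pass. [folklore] -/
def hornerN : List Bool → ℕ × ℕ → ℕ × ℕ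
  | [], p => p
  | b :: V, p => hornerN V (stepN b p)

/-- Semantics of `take1` (cost `≤ 3`). [folklore] -/
theorem runs_take1 (a2 bud : ℕ) (zi zv zacc zo : List Bool) :
    Runs take1 (mk zi (un bud) zv zacc (un a2) zo)
      (mk zi (un (takeN (a2, bud)).2) zv zacc (un (takeN (a2, bud)).1) zo) 3 := by
  unfold take1 takeN
  rcases bud with _ | bud
  · simpa using (Runs.pop_nil (k := Rg.tt) (push .acc2 true) (push .acc2 true)
      (R := mk zi (un 0) zv zacc (un a2) zo) rfl (Runs.skip _)).mono (show 0 + 2 ≤ 3 by norm_num)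
  · simpa [un_succ] using Runs.pop_true' (k := Rg.tt) (push .acc2 true) skip
      (R := mk zi (un (bud + 1)) zv zacc (un a2) zo) (w := un bud) rfl (update_tt ..)
      (Runs.push' (update_acc2 ..))

/-- **Semantics of the capped doubling** (cost `≤ 6 acc + 1`). [folklore] -/
theorem runs_dbl : ∀ (acc a2 bud : ℕ) (zi zv zo : List Bool),
    Runs dbl (mk zi (un bud) zv (un acc) (un a2) zo)
      (mk zi (un (bud - min acc bud)) zv [] (un (a2 + acc + min acc bud)) zo) (6 * acc + 1)
  | 0, a2, bud, zi, zv, zo => by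
    have h : Runs dbl (mk zi (un bud) zv [] (un a2) zo) (mk zi (un bud) zv [] (un a2) zo) 1 :=
      Runs.loop_nil (k := Rg.acc) dblBody dblBody rfl
    simpa using h
  | acc + 1, a2, bud, zi, zv, zo => by
    have hbody : Runs dblBody (mk zi (un bud) zv (un acc) (un a2) zo)
        (mk zi (un (takeN (a2 + 1, bud)).2) zv (un acc) (un (takeN (a2 + 1, bud)).1) zo) (1 + 3) :=
      Runs.seq (Runs.push' (update_acc2 ..)) (runs_take1 (a2 + 1) bud zi zv (un acc) zo)
    have ih := runs_dbl acc (takeN (a2 + 1, bud)).1 (takeN (a2 + 1, bud)).2 zi zv zo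
    have e1 : (takeN (a2 + 1, bud)).2 - min acc (takeN (a2 + 1, bud)).2 = bud - min (acc + 1) bud := by
      simp only [takeN]; split_ifs with h <;> simp only [] at h ⊢ <;> omega
    have e2 : (takeN (a2 + 1, bud)).1 + acc + min acc (takeN (a2 + 1, bud)).2 =
        a2 + (acc + 1) + min (acc + 1) bud := by
      simp only [takeN]; split_ifs with h <;> simp only [] at h ⊢ <;> omega
    rw [e1, e2] at ih
    have hcost : 6 * (acc + 1) + 1 = (1 + 3) + 2 + (6 * acc + 1) := by ring
    rw [hcost]
    exact Runs.loop_true' (R := mk zi (un bud) zv (un (acc + 1)) (un a2) zo) rfl (update_acc ..) hbody ih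

/-- **Semantics of one Horner step** (cost `≤ 12 (acc + bud) + 9`). [folklore] -/
theorem runs_stepB (b : Bool) (acc bud : ℕ) (zi zv zo : List Bool) :
    Runs (stepB b) (mk zi (un bud) zv (un acc) [] zo)
      (mk zi (un (stepN b (acc, bud)).2) zv (un (stepN b (acc, bud)).1) [] zo) (12 * (acc + bud) + 9) := by
  have h1 := runs_dbl acc 0 bud zi zv zo
  simp only [Nat.zero_add] at h1
  set q : ℕ × ℕ := (acc + min acc bud, bud - min acc bud) with hq
  have h2 : Runs (bif b then take1 else skip) (mk zi (un q.2) zv [] (un q.1) zo)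
      (mk zi (un (stepN b (acc, bud)).2) zv [] (un (stepN b (acc, bud)).1) zo) 3 := by
    cases b
    · simpa [stepN, ← hq] using (Runs.skip (mk zi (un q.2) zv [] (un q.1) zo)).mono (Nat.zero_le 3)
    · simpa [stepN, ← hq] using runs_take1 q.1 q.2 zi zv [] zo
  have h3 : Runs (pour .acc2 .acc) (mk zi (un (stepN b (acc, bud)).2) zv [] (un (stepN b (acc, bud)).1) zo)
      (mk zi (un (stepN b (acc, bud)).2) zv (un (stepN b (acc, bud)).1) [] zo)
      (3 * (stepN b (acc, bud)).1 + 1) := by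
    have := runs_pour (a := Rg.acc2) (b := Rg.acc) (by decide)
      (mk zi (un (stepN b (acc, bud)).2) zv [] (un (stepN b (acc, bud)).1) zo)
    simpa using this
  refine (Runs.seq h1 (Runs.seq h2 h3)).mono ?_
  have hle : (stepN b (acc, bud)).1 ≤ 2 * acc + 1 := by
    cases b
    · simp [stepN]; omega
    · by_cases hz : bud - min acc bud = 0 <;> simp [stepN, takeN, hz] <;> omega
  omega

/-- The Horner step preserves `acc + bud`. [folklore] -/
theorem stepN_sum (b : Bool) (p : ℕ × ℕ) : (stepN b p).1 + (stepN b p).2 = p.1 + p.2 := by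
  cases b
  · simp only [stepN, cond_false]; omega
  · by_cases hz : p.2 - min p.1 p.2 = 0 <;> simp [stepN, takeN, hz] <;> omega

/-- The Horner pass preserves `acc + bud`. [folklore] -/
theorem hornerN_sum : ∀ (V : List Bool) (p : ℕ × ℕ), (hornerN V p).1 + (hornerN V p).2 = p.1 + p.2
  | [], p => rfl
  | b :: V, p => by rw [hornerN, hornerN_sum V, stepN_sum]

/-- **Semantics of the Horner pass** (cost `≤ |v| · (12 (acc + bud) + 11) + 1`). [folklore] -/
theorem runs_horner : ∀ (V : List Bool) (acc bud : ℕ) (zi zo : List Bool),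
    Runs horner (mk zi (un bud) V (un acc) [] zo)
      (mk zi (un (hornerN V (acc, bud)).2) [] (un (hornerN V (acc, bud)).1) [] zo)
      (V.length * (12 * (acc + bud) + 11) + 1)
  | [], acc, bud, zi, zo => by
    have h : Runs horner (mk zi (un bud) [] (un acc) [] zo) (mk zi (un bud) [] (un acc) [] zo) 1 :=
      Runs.loop_nil (k := Rg.v) (stepB true) (stepB false) rfl
    simpa [hornerN] using h
  | b :: V, acc, bud, zi, zo => by
    have hb := runs_stepB b acc bud zi V zo
    have ih := runs_horner V (stepN b (acc, bud)).1 (stepN b (acc, bud)).2 zi zo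
    have hsum := stepN_sum b (acc, bud)
    simp only at hsum
    rw [hsum] at ih
    have hcost : (b :: V).length * (12 * (acc + bud) + 11) + 1 =
        (12 * (acc + bud) + 9) + 2 + (V.length * (12 * (acc + bud) + 11) + 1) := by
      simp; ring
    rw [hcost]
    cases b
    · exact Runs.loop_false' (R := mk zi (un bud) (false :: V) (un acc) [] zo) rfl (update_v ..) hb ih
    · exact Runs.loop_true' (R := mk zi (un bud) (true :: V) (un acc) [] zo) rfl (update_v ..) hb ih

/-! #### Arithmetic of the capped Horner pass -/

/-- Reading bits most significant first: `msbVal p V = p · 2^{|V|} + (value of V)`. [folklore] -/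
def msbVal (p : ℕ) (V : List Bool) : ℕ := V.foldl (fun q b => 2 * q + b.toNat) p

/-- `msbVal` of a reversed little-endian numeral. [folklore] -/
theorem msbVal_reverse (p : ℕ) : ∀ w : List Bool, msbVal p w.reverse = p * 2 ^ w.length + bitsToNat w
  | [] => by simp [msbVal]
  | c :: w => by
    have ih := msbVal_reverse p w
    simp only [msbVal] at ih ⊢
    rw [List.reverse_cons, List.foldl_append, ih, List.foldl_cons, List.foldl_nil, bitsToNat_cons,
      List.length_cons, pow_succ]
    ring

/-- The invariant of the capped Horner pass: `acc = min p T`, `acc + bud = T`. [folklore] -/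
def Inv (T p : ℕ) (s : ℕ × ℕ) : Prop := s.1 = min p T ∧ s.1 + s.2 = T

/-- One step preserves the invariant, reading one more bit. [folklore] -/
theorem Inv.step {T p : ℕ} {s : ℕ × ℕ} (h : Inv T p s) (b : Bool) :
    Inv T (2 * p + b.toNat) (stepN b s) := by
  obtain ⟨h1, h2⟩ := h
  obtain ⟨a, bud⟩ := s
  simp only at h1 h2
  constructor
  · cases b
    · simp [stepN]; omega
    · by_cases hz : bud - min a bud = 0 <;> simp [stepN, takeN, hz] <;> omega
  · have := stepN_sum b (a, bud); simp at this; omega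

/-- The pass preserves the invariant, reading all of `V`. [folklore] -/
theorem Inv.pass {T : ℕ} : ∀ (V : List Bool) {p : ℕ} {s : ℕ × ℕ}, Inv T p s →
    Inv T (msbVal p V) (hornerN V s)
  | [], _, _, h => h
  | b :: V, p, s, h => by
    show Inv T (msbVal (2 * p + b.toNat) V) (hornerN V (stepN b s))
    exact Inv.pass V (h.step b)

/-- **The budget is exhausted iff `T ≤ v`**: on `v = reverse (encodeNat n)` from `(0, T)`, the final
budget is `T - min n T`. [folklore] -/
theorem hornerN_encodeNat (T n : ℕ) :
    (hornerN (encodeNat n).reverse (0, T)).2 = T - min n T := by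
  have h0 : Inv T 0 (0, T) := ⟨by simp, by simp⟩
  have h := Inv.pass (encodeNat n).reverse h0
  rw [msbVal_reverse, bitsToNat_encodeNat, zero_mul, zero_add] at h
  obtain ⟨h1, h2⟩ := h
  omega

/-! #### Output and the whole program -/

/-- Output `[true]` iff the budget is exhausted. [folklore] -/
def output : Com Rg := pop .tt (push .out false) (push .out false) (push .out true)

/-- Semantics of `output` (cost `≤ 3`). [folklore] -/
theorem runs_output (bud : ℕ) (zi zv zacc zacc2 : List Bool) :
    Runs output (mk zi (un bud) zv zacc zacc2 []) (mk zi (un (bud - 1)) zv zacc zacc2 [decide (bud = 0)]) 3 := by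
  unfold output
  rcases bud with _ | bud
  · simpa using Runs.pop_nil (k := Rg.tt) (push .out false) (push .out false)
      (R := mk zi (un 0) zv zacc zacc2 []) rfl (Runs.push' (update_out ..))
  · simpa [un_succ] using Runs.pop_true' (k := Rg.tt) (push .out false) (push .out true)
      (R := mk zi (un (bud + 1)) zv zacc zacc2 []) (w := un bud) rfl (update_tt ..)
      (Runs.push' (update_out ..))

/-- The threshold program. [folklore] -/
def prog : Com Rg := parse ;; horner ;; output

end UnLeBin

open UnLeBin in
/-- **The function computed by the threshold program** (its functional semantics on every input):
`[true]` iff the Horner budget is exhausted. [folklore] -/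
def unLeBinFn (z : List Bool) : List Bool :=
  [decide ((UnLeBin.hornerN (UnLeBin.parseSpec z 0).2 (0, (UnLeBin.parseSpec z 0).1)).2 = 0)]

open UnLeBin Com in
/-- **The threshold program computes `unLeBinFn` in quadratic time** (`12|z|² + 16|z| + 5` steps). [folklore] -/
theorem UnLeBin.runs_prog (z : List Bool) :
    ∃ R', Runs prog (Regs.init Rg.inp z) R' (12 * z.length ^ 2 + 16 * z.length + 5) ∧
      R' .out = unLeBinFn z := by
  rw [init_eq]
  set T := (parseSpec z 0).1 with hT
  set V := (parseSpec z 0).2 with hV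
  have hle := parseSpec_le z 0
  rw [← hT, ← hV, Nat.zero_add] at hle
  have h1 : Runs parse (mk z [] [] [] [] []) (mk [] (un T) V [] [] []) (5 * z.length + 1) := by
    have := runs_parse z 0 [] [] []
    rwa [← hT, ← hV] at this
  have h2 := runs_horner V 0 T [] []
  set s := hornerN V (0, T) with hs
  have h3 := runs_output s.2 [] [] (un s.1) []
  refine ⟨_, (Runs.seq h1 (Runs.seq h2 h3)).mono ?_, by simp [unLeBinFn, ← hT, ← hV, ← hs]⟩
  have hV' : V.length ≤ z.length := by omega
  have hT' : T ≤ z.length := by omega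
  have h4 : V.length * (12 * (0 + T) + 11) ≤ z.length * (12 * z.length + 11) :=
    Nat.mul_le_mul hV' (by omega)
  have h5 : z.length * (12 * z.length + 11) = 12 * z.length ^ 2 + 11 * z.length := by ring
  omega

/-- **The unary/binary threshold test is polynomial time**: `unLeBinFn ∈ FP`. [cite: AroraBarakCC2009, §1.3] -/
theorem unLeBinFn_mem_FP : unLeBinFn ∈ FP :=
  Com.mem_FP UnLeBin.prog UnLeBin.Rg.inp UnLeBin.Rg.out (12 * Polynomial.X ^ 2 + 16 * Polynomial.X + 5)
    unLeBinFn fun z => by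
      obtain ⟨R', h, hout⟩ := UnLeBin.runs_prog z
      exact ⟨R', Or.inl (by simpa using h), hout⟩

/-- **`unLeBinFn ⟨u, bin v⟩ = [|u| ≤ v]`.** [folklore] -/
theorem unLeBinFn_boolPair (u : List Bool) (v : ℕ) :
    unLeBinFn (boolPair u (encodeNat v)) = [decide (u.length ≤ v)] := by
  rw [unLeBinFn, UnLeBin.parseSpec_boolPair, Nat.zero_add, UnLeBin.hornerN_encodeNat]
  simp only [List.cons.injEq, and_true]
  rw [decide_eq_decide]
  omega

/-- The same, with Mathlib's `encodeBool`. [folklore] -/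
theorem unLeBinFn_boolPair_eq_encodeBool (u : List Bool) (v : ℕ) :
    unLeBinFn (boolPair u (encodeNat v)) = encodeBool (decide (u.length ≤ v)) := by
  rw [unLeBinFn_boolPair]; rfl

end Literature.Computability.Complexity
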